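import Mathlib
import HarnessLib
import Summits.CriticalPhenomena.Ising3DConformalLimit.Theorems.BernsteinTemperaturePlanarPressureAMSeq
import Summits.CriticalPhenomena.Ising3DConformalLimit.Theorems.BernsteinTemperaturePlanarPressureAMPullback

/-!
# Route BernsteinTemperature, item `PlanarPressureAM` — file F: Taylor coefficients of `Y = G ∘ x`

Helper file (supports item `stmt-CriticalPhenomena-10768`). For a coefficient sequence `c` with
`|cₙ| ≤ 1`, `c₀ = 1` and the `₂F₁(½,½;1;·)` ratio, the germ at `w = 0` of
`Y(w) = ∑ cₙ x(w)ⁿ`, `x(w) = 16w(1-w)²/(1+w)⁴`, has Taylor coefficients `y` with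
`y₀..y₄ = 1, 4, 12, 44, 188` satisfying the order-five recurrence of file A
(`BernsteinTemperaturePlanarPressureAMSeq`). Method: the pulled-back hypergeometric equation
(file E) holds near `0`; expand every term as a germ (file B) and compare coefficients.

No definitions are introduced.
-/

namespace Summit.CriticalPhenomena.Ising3DConformalLimit.Theorems

open Filter Topology FormalMultilinearSeries Set
open scoped ENNReal NNReal

/-- Linear combination of three germs. [folklore] -/
theorem planarPressureAM_germ_lin3 {f g h : ℝ → ℝ} {a b e : ℕ → ℝ}
    (ha : ∀ᶠ z in 𝓝 (0 : ℝ), HasSum (fun n => a n * z ^ n) (f z))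
    (hb : ∀ᶠ z in 𝓝 (0 : ℝ), HasSum (fun n => b n * z ^ n) (g z))
    (he : ∀ᶠ z in 𝓝 (0 : ℝ), HasSum (fun n => e n * z ^ n) (h z)) (α β γ : ℝ) :
    ∀ᶠ z in 𝓝 (0 : ℝ), HasSum (fun n => (α * a n + β * b n + γ * e n) * z ^ n)
      (α * f z + β * g z + γ * h z) := by
  filter_upwards [ha, hb, he] with z hz1 hz2 hz3
  have := ((hz1.mul_left α).add (hz2.mul_left β)).add (hz3.mul_left γ)
  refine this.congr_fun fun n => ?_
  ring

/-- Sum of two germs. [folklore] -/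
theorem planarPressureAM_germ_add {f g : ℝ → ℝ} {a b : ℕ → ℝ}
    (ha : ∀ᶠ z in 𝓝 (0 : ℝ), HasSum (fun n => a n * z ^ n) (f z))
    (hb : ∀ᶠ z in 𝓝 (0 : ℝ), HasSum (fun n => b n * z ^ n) (g z)) :
    ∀ᶠ z in 𝓝 (0 : ℝ), HasSum (fun n => (a n + b n) * z ^ n) (f z + g z) := by
  filter_upwards [ha, hb] with z hz1 hz2
  refine (hz1.add hz2).congr_fun fun n => ?_
  ring

/-- Rewriting the coefficients of a germ. [folklore] -/
theorem planarPressureAM_germ_congr {f : ℝ → ℝ} {a b : ℕ → ℝ}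
    (ha : ∀ᶠ z in 𝓝 (0 : ℝ), HasSum (fun n => a n * z ^ n) (f z)) (h : ∀ n, a n = b n) :
    ∀ᶠ z in 𝓝 (0 : ℝ), HasSum (fun n => b n * z ^ n) (f z) := by
  have : a = b := funext h
  subst this
  exact ha

/-- `0 ∈ J = (-1/32, 3 - 2√2)` and `J` is a neighbourhood of `0`. [folklore] -/
theorem planarPressureAM_J_nhds :
    (0 : ℝ) ∈ Ioo (-(1 / 32 : ℝ)) (3 - 2 * Real.sqrt 2) ∧
      Ioo (-(1 / 32 : ℝ)) (3 - 2 * Real.sqrt 2) ∈ 𝓝 (0 : ℝ) := by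
  have hs2' : Real.sqrt 2 < (1.41422 : ℝ) := by
    rw [Real.sqrt_lt' (by norm_num)]; norm_num
  have h0 : (0 : ℝ) ∈ Ioo (-(1 / 32 : ℝ)) (3 - 2 * Real.sqrt 2) := ⟨by norm_num, by linarith⟩
  exact ⟨h0, isOpen_Ioo.mem_nhds h0⟩

/-- The Taylor coefficients `y` of `Y = G ∘ x` at `0`: existence, initial values
`1, 4, 12, 44, 188` and the order-five recurrence. [folklore] -/
theorem planarPressureAM_Y_coeffs (c : ℕ → ℝ) (hle : ∀ n, |c n| ≤ 1) (hc0 : c 0 = 1)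
    (hratio : ∀ n : ℕ, 4 * ((n : ℝ) + 1) ^ 2 * c (n + 1) = (2 * (n : ℝ) + 1) ^ 2 * c n) :
    ∃ y : ℕ → ℝ,
      (∀ᶠ w in 𝓝 (0 : ℝ), HasSum (fun n => y n * w ^ n)
        (∑' n, c n * (16 * w * (1 - w) ^ 2 / (1 + w) ^ 4) ^ n)) ∧
      y 0 = 1 ∧ y 1 = 4 ∧ y 2 = 12 ∧ y 3 = 44 ∧ y 4 = 188 ∧
      (∀ m : ℕ, ((m : ℝ) + 5) ^ 2 * y (m + 5) =
        (5 * ((m : ℝ) + 4) ^ 2 + 10 * ((m : ℝ) + 4) + 4) * y (m + 4)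
        + (6 * ((m : ℝ) + 4) ^ 2 - 30 * ((m : ℝ) + 4) - 4) * y (m + 3)
        - (6 * ((m : ℝ) + 4) ^ 2 - 6 * ((m : ℝ) + 4) - 40) * y (m + 2)
        - (5 * ((m : ℝ) + 4) ^ 2 - 40 * ((m : ℝ) + 4) + 79) * y (m + 1)
        + (m : ℝ) ^ 2 * y m) := by
  obtain ⟨h0J, hJ⟩ := planarPressureAM_J_nhds
  -- the germ of `Y`
  obtain ⟨y, gy⟩ := planarPressureAM_germ_of_analyticAt (planarPressureAM_Y_analyticAt c hle h0J)
  refine ⟨y, gy, ?_⟩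
  -- `y 0 = 1`
  have hy0 : y 0 = 1 := by
    have h := planarPressureAM_germ_apply_zero gy
    rw [← h]
    have hG0 := planarPressureAM_germ_apply_zero
      (planarPressureAM_germ_iff.mpr (planarPressureAM_G_onBall c hle).hasFPowerSeriesAt)
    simpa using hG0.trans hc0
  -- germs of `Y'` and `Y''`
  have g1 := planarPressureAM_deriv_germ gy
  have g2 := planarPressureAM_germ_congr (planarPressureAM_deriv_germ g1)
    (b := fun n : ℕ => ((n : ℝ) + 1) * ((n : ℝ) + 2) * y (n + 2)) (fun n => by push_cast; ring)
  -- the seven groups `w ^ k (α_k Y'' + β_k Y' + γ_k Y)`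
  have t0 := planarPressureAM_germ_lin3 g2 g1 gy 0 1 (-4)
  have t1 := planarPressureAM_pow_mul_germ (planarPressureAM_germ_lin3 g2 g1 gy 1 (-15) 28) 1
  have t2 := planarPressureAM_pow_mul_germ (planarPressureAM_germ_lin3 g2 g1 gy (-5) 12 (-28)) 2
  have t3 := planarPressureAM_pow_mul_germ (planarPressureAM_germ_lin3 g2 g1 gy (-6) 24 4) 3
  have t4 := planarPressureAM_pow_mul_germ (planarPressureAM_germ_lin3 g2 g1 gy 6 (-5) 0) 4
  have t5 := planarPressureAM_pow_mul_germ (planarPressureAM_germ_lin3 g2 g1 gy 5 (-1) 0) 5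
  have t6 := planarPressureAM_pow_mul_germ (planarPressureAM_germ_lin3 g2 g1 gy (-1) 0 0) 6
  have tot := planarPressureAM_germ_add (planarPressureAM_germ_add (planarPressureAM_germ_add
    (planarPressureAM_germ_add (planarPressureAM_germ_add (planarPressureAM_germ_add t0 t1) t2)
      t3) t4) t5) t6
  -- the sum of the seven groups vanishes on `J`
  have hode : ∀ᶠ w in 𝓝 (0 : ℝ),
      (0 * deriv (deriv (fun w : ℝ => ∑' n, c n * (16 * w * (1 - w) ^ 2 / (1 + w) ^ 4) ^ n)) w
        + 1 * deriv (fun w : ℝ => ∑' n, c n * (16 * w * (1 - w) ^ 2 / (1 + w) ^ 4) ^ n) w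
        + (-4) * (∑' n, c n * (16 * w * (1 - w) ^ 2 / (1 + w) ^ 4) ^ n))
      + w ^ 1 * (1 * deriv (deriv (fun w : ℝ => ∑' n, c n * (16 * w * (1 - w) ^ 2 / (1 + w) ^ 4) ^ n)) w
        + (-15) * deriv (fun w : ℝ => ∑' n, c n * (16 * w * (1 - w) ^ 2 / (1 + w) ^ 4) ^ n) w
        + 28 * (∑' n, c n * (16 * w * (1 - w) ^ 2 / (1 + w) ^ 4) ^ n))
      + w ^ 2 * ((-5) * deriv (deriv (fun w : ℝ => ∑' n, c n * (16 * w * (1 - w) ^ 2 / (1 + w) ^ 4) ^ n)) w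
        + 12 * deriv (fun w : ℝ => ∑' n, c n * (16 * w * (1 - w) ^ 2 / (1 + w) ^ 4) ^ n) w
        + (-28) * (∑' n, c n * (16 * w * (1 - w) ^ 2 / (1 + w) ^ 4) ^ n))
      + w ^ 3 * ((-6) * deriv (deriv (fun w : ℝ => ∑' n, c n * (16 * w * (1 - w) ^ 2 / (1 + w) ^ 4) ^ n)) w
        + 24 * deriv (fun w : ℝ => ∑' n, c n * (16 * w * (1 - w) ^ 2 / (1 + w) ^ 4) ^ n) w
        + 4 * (∑' n, c n * (16 * w * (1 - w) ^ 2 / (1 + w) ^ 4) ^ n))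
      + w ^ 4 * (6 * deriv (deriv (fun w : ℝ => ∑' n, c n * (16 * w * (1 - w) ^ 2 / (1 + w) ^ 4) ^ n)) w
        + (-5) * deriv (fun w : ℝ => ∑' n, c n * (16 * w * (1 - w) ^ 2 / (1 + w) ^ 4) ^ n) w
        + 0 * (∑' n, c n * (16 * w * (1 - w) ^ 2 / (1 + w) ^ 4) ^ n))
      + w ^ 5 * (5 * deriv (deriv (fun w : ℝ => ∑' n, c n * (16 * w * (1 - w) ^ 2 / (1 + w) ^ 4) ^ n)) w
        + (-1) * deriv (fun w : ℝ => ∑' n, c n * (16 * w * (1 - w) ^ 2 / (1 + w) ^ 4) ^ n) w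
        + 0 * (∑' n, c n * (16 * w * (1 - w) ^ 2 / (1 + w) ^ 4) ^ n))
      + w ^ 6 * ((-1) * deriv (deriv (fun w : ℝ => ∑' n, c n * (16 * w * (1 - w) ^ 2 / (1 + w) ^ 4) ^ n)) w
        + 0 * deriv (fun w : ℝ => ∑' n, c n * (16 * w * (1 - w) ^ 2 / (1 + w) ^ 4) ^ n) w
        + 0 * (∑' n, c n * (16 * w * (1 - w) ^ 2 / (1 + w) ^ 4) ^ n)) = 0 := by
    filter_upwards [hJ] with w hw
    have h := planarPressureAM_Y_ode c hle hratio hw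
    linear_combination h
  have tot0 : ∀ᶠ w in 𝓝 (0 : ℝ), HasSum (fun n => (0 : ℝ) * w ^ n) ((fun _ : ℝ => (0 : ℝ)) w) :=
    Filter.Eventually.of_forall fun w => by simp
  have tot' := tot.and hode
  have hE := planarPressureAM_germ_unique (f := fun _ : ℝ => (0 : ℝ))
    (tot'.mono fun w hw => by simpa only [hw.2] using hw.1) tot0
  -- read off the coefficients
  have E := fun n => congrFun hE n
  have e0 := E 0
  have e1 := E 1
  have e2' := E 2
  have e3 := E 3
  have e4 := E 4
  have e5 := E 5
  norm_num at e0 e1 e2' e3 e4 e5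
  have hy1 : y 1 = 4 := by linarith
  have hy2 : y 2 = 12 := by rw [hy0, hy1] at e1; linarith
  have hy3 : y 3 = 44 := by rw [hy0, hy1, hy2] at e2'; linarith
  have hy4 : y 4 = 188 := by rw [hy0, hy1, hy2, hy3] at e3; linarith
  refine ⟨hy0, hy1, hy2, hy3, hy4, fun m => ?_⟩
  rcases m with _ | _ | m
  · norm_num; linarith
  · norm_num; linarith
  · have em := E (m + 6)
    have hm1 : ¬ (m + 6 < 1) := by omega
    have hm2 : ¬ (m + 6 < 2) := by omega
    have hm3 : ¬ (m + 6 < 3) := by omega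
    have hm4 : ¬ (m + 6 < 4) := by omega
    have hm5 : ¬ (m + 6 < 5) := by omega
    have hm6 : ¬ (m + 6 < 6) := by omega
    have hs1 : m + 6 - 1 = m + 5 := by omega
    have hs2 : m + 6 - 2 = m + 4 := by omega
    have hs3 : m + 6 - 3 = m + 3 := by omega
    have hs4 : m + 6 - 4 = m + 2 := by omega
    have hs5 : m + 6 - 5 = m + 1 := by omega
    have hs6 : m + 6 - 6 = m := by omega
    simp only [hm1, hm2, hm3, hm4, hm5, hm6, hs1, hs2, hs3, hs4, hs5, hs6, if_false] at em
    push_cast at em ⊢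
    linarith

/-- The Taylor series of `R(w) = log((1+w)/(1-w)) - Φ(x(w))/4` at `0` has non-negative coefficients
and converges to `R` on `[0, 3 - 2√2)`. The coefficients satisfy
`4(m+3) r_{m+3} = 4(m+1) r_{m+1} + (6 y_{m+2} - y_{m+3} - y_{m+1})` with the non-negative bracket of
file A, `r₀ = 0`, `r₁ = 1`, `r₂ = 3/2`, and `0 ≤ r_m ≤ 2 λ^m`; the identity theorem (file B)
transfers the germ identity to the whole interval. [folklore] -/
theorem planarPressureAM_R_series (c : ℕ → ℝ) (hle : ∀ n, |c n| ≤ 1) (hc0 : c 0 = 1)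
    (hratio : ∀ n : ℕ, 4 * ((n : ℝ) + 1) ^ 2 * c (n + 1) = (2 * (n : ℝ) + 1) ^ 2 * c n) :
    ∃ r : ℕ → ℝ, (∀ n, 0 ≤ r n) ∧ ∀ w : ℝ, 0 ≤ w → w < 3 - 2 * Real.sqrt 2 →
      HasSum (fun n => r n * w ^ n) (Real.log ((1 + w) / (1 - w))
        - (1 / 4) * ∑' n, (c n / n) * (16 * w * (1 - w) ^ 2 / (1 + w) ^ 4) ^ n) := by
  obtain ⟨h0J, hJ⟩ := planarPressureAM_J_nhds
  obtain ⟨y, gy, hy0, hy1, hy2, hy3, hy4, hrec⟩ := planarPressureAM_Y_coeffs c hle hc0 hratio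
  -- `λ = 3 + 2√2`
  set L : ℝ := 3 + 2 * Real.sqrt 2 with hL_def
  have hsq : Real.sqrt 2 ^ 2 = 2 := Real.sq_sqrt (by norm_num)
  have hs1 : (1 : ℝ) ≤ Real.sqrt 2 := by
    rw [show (1 : ℝ) = Real.sqrt 1 by simp]; exact Real.sqrt_le_sqrt (by norm_num)
  have hL : L ^ 2 = 6 * L - 1 := by rw [hL_def]; nlinarith
  have hL5 : 5 ≤ L := by rw [hL_def]; linarith
  have hLinv : L * (3 - 2 * Real.sqrt 2) = 1 := by rw [hL_def]; nlinarith
  have hconv := planarPressureAM_seq_convex y L hL hL5 hy0 hy1 hy2 hy3 hy4 hrec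
  have hypos := planarPressureAM_seq_pos y L hL hL5 hy0 hy1 hy2 hy3 hy4 hrec
  have hypow := planarPressureAM_seq_le_pow y L hL hL5 hy0 hy1 hy2 hy3 hy4 hrec
  -- the germ of `R`
  obtain ⟨r, gr⟩ := planarPressureAM_germ_of_analyticAt (planarPressureAM_R_analyticAt c hle h0J)
  have hr0 : r 0 = 0 := by
    have h := planarPressureAM_germ_apply_zero gr
    rw [← h]
    have hP0 := planarPressureAM_germ_apply_zero
      (planarPressureAM_germ_iff.mpr (planarPressureAM_Phi_onBall c hle).hasFPowerSeriesAt)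
    simp only [Nat.cast_zero, div_zero] at hP0
    simp [hP0]
  -- germs of both sides of `4 w (1 - w²) R' = (1 + w)² - (1 - 6w + w²) Y`
  have g1 := planarPressureAM_deriv_germ gr
  have u1 := planarPressureAM_pow_mul_germ g1 1
  have u3 := planarPressureAM_pow_mul_germ g1 3
  have lhs := planarPressureAM_germ_lin3 u1 u3 gy 4 (-4) 0
  have v1 := planarPressureAM_pow_mul_germ gy 1
  have v2 := planarPressureAM_pow_mul_germ gy 2
  have prodY := planarPressureAM_germ_lin3 gy v1 v2 1 (-6) 1
  have poly := planarPressureAM_poly_germ (fun i => if i = 0 then 1 else if i = 1 then 2 else 1) 3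
  have rhs := planarPressureAM_germ_lin3 poly prodY gy 1 (-1) 0
  -- both are germs of the same function
  have key : ∀ᶠ w in 𝓝 (0 : ℝ),
      4 * (w ^ 1 * deriv (fun w : ℝ => Real.log ((1 + w) / (1 - w))
        - (1 / 4) * ∑' n, (c n / n) * (16 * w * (1 - w) ^ 2 / (1 + w) ^ 4) ^ n) w)
      + (-4) * (w ^ 3 * deriv (fun w : ℝ => Real.log ((1 + w) / (1 - w))
        - (1 / 4) * ∑' n, (c n / n) * (16 * w * (1 - w) ^ 2 / (1 + w) ^ 4) ^ n) w)
      + 0 * (∑' n, c n * (16 * w * (1 - w) ^ 2 / (1 + w) ^ 4) ^ n)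
      = 1 * (∑ i ∈ Finset.range 3, (if i = 0 then (1 : ℝ) else if i = 1 then 2 else 1) * w ^ i)
        + (-1) * (1 * (∑' n, c n * (16 * w * (1 - w) ^ 2 / (1 + w) ^ 4) ^ n)
          + (-6) * (w ^ 1 * ∑' n, c n * (16 * w * (1 - w) ^ 2 / (1 + w) ^ 4) ^ n)
          + 1 * (w ^ 2 * ∑' n, c n * (16 * w * (1 - w) ^ 2 / (1 + w) ^ 4) ^ n))
        + 0 * (∑' n, c n * (16 * w * (1 - w) ^ 2 / (1 + w) ^ 4) ^ n) := by
    filter_upwards [hJ] with w hw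
    have h := planarPressureAM_R_deriv c hle hw
    rw [hc0] at h
    simp only [Finset.sum_range_succ, Finset.sum_range_zero]
    norm_num
    linear_combination h
  have lhs' := (lhs.and key).mono fun w hw => by
    have := hw.1
    rw [hw.2] at this
    exact this
  have hEq := planarPressureAM_germ_unique lhs' rhs
  have E := fun n => congrFun hEq n
  have e1 := E 1
  have e2 := E 2
  norm_num at e1 e2
  have hr1 : r 1 = 1 := by rw [hy0, hy1] at e1; linarith
  have hr2 : r 2 = 3 / 2 := by rw [hy0, hy1, hy2] at e2; linarith
  have hstep : ∀ m : ℕ, 4 * ((m : ℝ) + 3) * r (m + 3)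
      = 4 * ((m : ℝ) + 1) * r (m + 1) + (6 * y (m + 2) - y (m + 3) - y (m + 1)) := by
    intro m
    have em := E (m + 3)
    have hm1 : ¬ (m + 3 < 1) := by omega
    have hm2 : ¬ (m + 3 < 2) := by omega
    have hm3 : ¬ (m + 3 < 3) := by omega
    have hs1 : m + 3 - 1 = m + 2 := by omega
    have hs2 : m + 3 - 2 = m + 1 := by omega
    have hs3 : m + 3 - 3 = m := by omega
    have hne0 : m + 3 ≠ 0 := by omega
    have hne1 : m + 3 ≠ 1 := by omega
    simp only [hm1, hm2, hm3, hs1, hs2, hs3, hne0, hne1, if_false] at em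
    push_cast at em
    linarith
  -- non-negativity
  have hnonneg : ∀ m : ℕ, 0 ≤ r m ∧ 0 ≤ r (m + 1) := by
    intro m
    induction m with
    | zero => exact ⟨by rw [hr0], by rw [hr1]; norm_num⟩
    | succ k ih =>
      refine ⟨ih.2, ?_⟩
      rcases k with _ | k
      · rw [hr2]; norm_num
      · have h := hstep k
        have hd := hconv (k + 1)
        have hk : (0 : ℝ) ≤ k := Nat.cast_nonneg k
        have : 0 ≤ 4 * ((k : ℝ) + 3) * r (k + 3) := by
          rw [h]
          have := ih.1
          have : 0 ≤ 4 * ((k : ℝ) + 1) * r (k + 1) := by positivity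
          linarith
        have h3 : (0 : ℝ) < 4 * ((k : ℝ) + 3) := by positivity
        exact le_of_mul_le_mul_left (by simpa using this) h3
  -- growth `r m ≤ 2 λ^m`
  have hgrow : ∀ m : ℕ, r m ≤ 2 * L ^ m ∧ r (m + 1) ≤ 2 * L ^ (m + 1) := by
    intro m
    induction m with
    | zero => exact ⟨by rw [hr0]; norm_num, by rw [hr1]; norm_num; linarith⟩
    | succ k ih =>
      refine ⟨ih.2, ?_⟩
      rcases k with _ | k
      · rw [hr2]; nlinarith
      · have h := hstep k
        have hk : (0 : ℝ) ≤ k := Nat.cast_nonneg k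
        have hy3 := (hypos (k + 3)).le
        have hy1' := (hypos (k + 1)).le
        have hy2' := hypow (k + 2)
        have hLk : 0 ≤ L ^ (k + 1) := by positivity
        have e3 : L ^ (k + 1 + 1 + 1) = L ^ 2 * L ^ (k + 1) := by ring
        have e2' : L ^ (k + 2) = L * L ^ (k + 1) := by ring
        have ih1 := ih.1
        -- (k+3) r_{k+3} ≤ (k+1) 2 L^{k+1} + (3/2) L^{k+2} ≤ 2 (k+3) L^{k+3}
        have hb : 4 * ((k : ℝ) + 3) * r (k + 3) ≤ 4 * ((k : ℝ) + 1) * (2 * L ^ (k + 1))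
            + 6 * (L * L ^ (k + 1)) := by
          rw [h, ← e2']
          have : 4 * ((k : ℝ) + 1) * r (k + 1) ≤ 4 * ((k : ℝ) + 1) * (2 * L ^ (k + 1)) :=
            mul_le_mul_of_nonneg_left ih1 (by positivity)
          linarith
        have htarget : 4 * ((k : ℝ) + 1) * (2 * L ^ (k + 1)) + 6 * (L * L ^ (k + 1))
            ≤ 4 * ((k : ℝ) + 3) * (2 * (L ^ 2 * L ^ (k + 1))) := by
          have h25 : (25 : ℝ) ≤ L ^ 2 := by nlinarith
          nlinarith [mul_nonneg hk hLk, mul_nonneg (mul_nonneg hk hLk) (sub_nonneg.2 h25),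
            mul_nonneg hLk (sub_nonneg.2 h25), mul_nonneg hLk (sub_nonneg.2 hL5)]
        rw [e3]
        have h3 : (0 : ℝ) < 4 * ((k : ℝ) + 3) := by positivity
        exact le_of_mul_le_mul_left (by linarith) h3
  -- transfer the germ identity to `[0, 3 - 2√2)` by the identity theorem
  have hRpos : (0 : ℝ) < 3 - 2 * Real.sqrt 2 := h0J.2
  have hC : ∀ n, |r n| * (3 - 2 * Real.sqrt 2) ^ n ≤ 2 := by
    intro n
    rw [abs_of_nonneg (hnonneg n).1]
    have h1 : r n * (3 - 2 * Real.sqrt 2) ^ n ≤ 2 * L ^ n * (3 - 2 * Real.sqrt 2) ^ n :=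
      mul_le_mul_of_nonneg_right (hgrow n).1 (by positivity)
    have h2 : L ^ n * (3 - 2 * Real.sqrt 2) ^ n = 1 := by
      rw [← mul_pow, hLinv, one_pow]
    nlinarith
  have hanal : AnalyticOnNhd ℝ (fun w : ℝ => Real.log ((1 + w) / (1 - w))
      - (1 / 4) * ∑' n, (c n / n) * (16 * w * (1 - w) ^ 2 / (1 + w) ^ 4) ^ n)
      (Ioo (-(1 / 32 : ℝ)) (3 - 2 * Real.sqrt 2)) :=
    fun w hw => planarPressureAM_R_analyticAt c hle hw
  have main := planarPressureAM_hasSum_of_analyticOnNhd hanal (by norm_num) hRpos gr hRpos hC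
  refine ⟨r, fun n => (hnonneg n).1, fun w hw0 hw1 => ?_⟩
  exact main w ⟨by linarith, hw1⟩ (by rwa [abs_of_nonneg hw0])

end Summit.CriticalPhenomena.Ising3DConformalLimit.Theorems
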